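import Summits.KontsevichZagierPeriods.KontsevichZagierPeriods.Theorems.LinRedNormalFormArrangementNormalFormSeparateTwoZeroCore
import Summits.KontsevichZagierPeriods.KontsevichZagierPeriods.Theorems.LinRedNormalFormArrangementNormalFormSeparateTwoZeroLower
import Summits.KontsevichZagierPeriods.KontsevichZagierPeriods.Theorems.LinRedNormalFormArrangementNormalFormSeparateTwoZeroChart
import Summits.KontsevichZagierPeriods.KontsevichZagierPeriods.Theorems.LinRedNormalFormArrangementNormalFormSeparateSplit

/-!
# The terminal theorem: termwise absolute convergence of the Taylor split

(Line `janus-bands`, crux `ArrangementNormalForm`, stub `stub_separateTwoZero` — separation in a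
good rational direction for PLANAR arrangement representations without fibres; part `Terminal`.)

`terminal` (registered as `separateTwoZero_terminal`): a terminal representation of the
far-first separation (polyhedral base cell, shape with all active letters equal to `ℓ`, every wall
harmless or through the vertex `V` with the cone condition and `ℓ ∋ V`) is congruent modulo
`KZ.relations` to a `ℤ`-combination of elements of `GG 1 1 0`: the Taylor split at `ℓ`
(`separatePos_taylor`, `separatePos_split`), whose termwise absolute convergence `hI` is LOCAL near
every point of the closed cell (`local_piece`: the shear chart at the point, the local core `core`
with the exponent inequality `exponent_lt` on the pole line, boundedness `core_away` off it) and
globalised by compactness (`integrableOn_of_forall_nhds`).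
-/

noncomputable section

open Set MeasureTheory Filter Topology
open scoped ENNReal

namespace Summit.KontsevichZagierPeriods.ArrangementNormalForm.JanusBands

open Literature.NumberTheory.Transcendental

namespace SepTwoZero

open SeparatePos MvPolynomial

section Local

variable {m' m : ℕ} (M : Fin m' → (Fin (1 + 1) → ℚ) × ℚ)
  (lo up : Fin 0 → Fin 0 ⊕ ((Fin (1 + 1) → ℚ) × ℚ))
  (L : Fin m → (Fin 1 → ℚ) × ℚ) (e : Fin m → ℕ) (ℓ : (Fin 1 → ℚ) × ℚ)
  (s : KZ.IntegralRep (1 + 1 + 0))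

/-- The rows of the base cell read in the shear chart at abscissa `x₀` along `ℓ`. -/
def grow (x₀ : ℝ) (j : Fin m') : ℝ × ℝ × ℝ :=
  (((M j).1 0 : ℝ) + (M j).1 1 * (ℓ.1 0 : ℝ), ((M j).1 1 : ℝ),
    ((M j).1 0 : ℝ) * x₀ + (M j).1 1 * ((ℓ.1 0 : ℝ) * x₀ + ℓ.2) + (M j).2)

/-- The chart rows are the rows read in the shear chart. -/
theorem aff_grow (x₀ : ℝ) (w : ℝ × ℝ) (j : Fin m') :
    aff (grow M ℓ x₀ j) w = ∑ i, ((M j).1 i : ℝ) *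
      (chart x₀ (ℓ.1 0) ℓ.2 w : Fin (1 + 1 + 0) → ℝ) (Fin.castAdd 0 i) + (M j).2 := by
  rw [rowval_eq, (chart_coord _ _ _ w).1, (chart_coord _ _ _ w).2]
  simp only [aff, grow]
  ring

/-- The shear chart maps the chart polygon onto the base cell. -/
theorem mem_chart_iff (hdom : s.domain = gDom 1 0 m' M lo up) (x₀ : ℝ) (w : ℝ × ℝ) :
    (chart x₀ (ℓ.1 0) ℓ.2 w : Fin (1 + 1 + 0) → ℝ) ∈ s.domain ↔ w ∈ Om (grow M ℓ x₀) := by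
  rw [hdom]
  simp only [gDom, mem_setOf_eq, IsEmpty.forall_iff, and_true, Om, aff_grow]

/-- The preimage of the base cell under the shear chart. -/
theorem preimage_chart (hdom : s.domain = gDom 1 0 m' M lo up) (x₀ : ℝ) :
    (fun w => (chart x₀ (ℓ.1 0) ℓ.2 w : Fin (1 + 1 + 0) → ℝ)) ⁻¹' s.domain = Om (grow M ℓ x₀) := by
  ext w; exact mem_chart_iff M lo up ℓ s hdom x₀ w

/-- Transfer of local integrability from the chart to the base plane. -/
theorem integrableOn_of_chart (hdom : s.domain = gDom 1 0 m' M lo up) (x₀ : ℝ)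
    {G : ℝ × ℝ → ℝ} {B : Set (ℝ × ℝ)} (hB : MeasurableSet B) {U : Set (Fin (1 + 1 + 0) → ℝ)}
    (hU : ∀ w, (chart x₀ (ℓ.1 0) ℓ.2 w : Fin (1 + 1 + 0) → ℝ) ∈ U ↔ w ∈ B)
    {f : (Fin (1 + 1 + 0) → ℝ) → ℝ}
    (hfG : ∀ w ∈ Om (grow M ℓ x₀) ∩ B, f (chart x₀ (ℓ.1 0) ℓ.2 w) = G w)
    (hI : IntegrableOn G (Om (grow M ℓ x₀) ∩ B)) : IntegrableOn f (s.domain ∩ U) := by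
  have key := ((measurePreserving_chart x₀ (ℓ.1 0) ℓ.2).integrableOn_comp_preimage
    (chart x₀ (ℓ.1 0) ℓ.2).measurableEmbedding (f := f) (s := s.domain ∩ U)).1
  refine key ?_
  have hset : (chart x₀ (ℓ.1 0) ℓ.2) ⁻¹' (s.domain ∩ U) = Om (grow M ℓ x₀) ∩ B := by
    ext w
    simp only [mem_preimage, mem_inter_iff]
    rw [mem_chart_iff M lo up ℓ s hdom x₀ w, hU w]
  rw [hset]
  exact hI.congr_fun (fun w hw => (hfG w hw).symm) ((measurableSet_Om _).inter hB)

end Local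

section LocalPiece

variable {m' m : ℕ} (M : Fin m' → (Fin (1 + 1) → ℚ) × ℚ)
  (lo up : Fin 0 → Fin 0 ⊕ ((Fin (1 + 1) → ℚ) × ℚ))
  (L : Fin m → (Fin 1 → ℚ) × ℚ) (e : Fin m → ℕ) (ℓ : (Fin 1 → ℚ) × ℚ)
  (s : KZ.IntegralRep (1 + 1 + 0))



/-- **Local integrability of the Taylor pieces of a terminal shape** near every point of the
closed base cell (the heart of `hI`): power counting at the vertex through the pole line, the
band vanishing lemma along polar edges, boundedness elsewhere. -/
theorem local_piece (hdom : s.domain = gDom 1 0 m' M lo up)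
    (a : Fin 0 → Option ((Fin (1 + 1) → ℚ) × ℚ)) (p : MvPolynomial (Fin (1 + 1)) ℚ) (n : ℕ)
    (hint : EqOn s.integrand (fun z => MvPolynomial.aeval (fun i => z (Fin.castAdd 0 i)) p /
      (∏ j, affB 1 0 (L j) z ^ e j) *
      (1 / (z (Fin.castAdd 0 (Fin.last 1)) - affB 1 0 ℓ z) ^ n) * fib 1 0 a z) s.domain)
    (hpole : n ≠ 0 → ∀ z ∈ s.domain, z (Fin.castAdd 0 (Fin.last 1)) - affB 1 0 ℓ z ≠ 0)
    (V : ℚ × ℚ)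
    (hInv : ∀ j, e j ≠ 0 → (∃ c₀ > 0, ∀ z ∈ s.domain, c₀ ≤ |affB 1 0 (L j) z|) ∨
      ((L j).1 0 ≠ 0 ∧ (L j).1 0 * V.1 + (L j).2 = 0 ∧ n ≠ 0 ∧ ℓ.1 0 * V.1 + ℓ.2 = V.2 ∧
        ∃ a₁ b₁ : ℚ, ∀ z ∈ s.domain, (a₁ : ℝ) * (z 0 - V.1) < z 1 - V.2 ∧
          z 1 - V.2 < (b₁ : ℝ) * (z 0 - V.1)))
    (N : ℕ) (q : ℕ → MvPolynomial (Fin 1) ℚ)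
    (hq : ∀ z : Fin (1 + 1 + 0) → ℝ, MvPolynomial.aeval (fun i => z (Fin.castAdd 0 i)) p =
      ∑ i ∈ Finset.range N, MvPolynomial.aeval (fun i => z (Fin.castAdd 0 (Fin.castSucc i))) (q i) *
        (z (Fin.castAdd 0 (Fin.last 1)) - affB 1 0 ℓ z) ^ i)
    (i : ℕ) (hi : i < N) :
    ∀ z₀ ∈ closure s.domain, ∃ U : Set (Fin (1 + 1 + 0) → ℝ), IsOpen U ∧ z₀ ∈ U ∧
      IntegrableOn (fun z => MvPolynomial.aeval (fun i => z (Fin.castAdd 0 (Fin.castSucc i)))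
        (q i) / (∏ j, affB 1 0 (L j) z ^ e j) *
        ((z (Fin.castAdd 0 (Fin.last 1)) - affB 1 0 ℓ z) ^ i /
          (z (Fin.castAdd 0 (Fin.last 1)) - affB 1 0 ℓ z) ^ n) * fib 1 0 a z) (s.domain ∩ U) := by
  intro z₀ hz₀
  -- the chart at `x₀ = z₀ 0` along `ℓ`
  set x₀ : ℝ := z₀ 0 with hx₀
  set sl : ℝ := (ℓ.1 0 : ℝ) with hsl
  set ic : ℝ := (ℓ.2 : ℝ) with hic
  set l₀ : ℝ := z₀ 1 - (sl * x₀ + ic) with hl₀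
  set Φ : ℝ × ℝ → (Fin (1 + 1 + 0) → ℝ) := fun w => chart x₀ sl ic w with hΦ
  obtain ⟨κ, hκ⟩ : ∃ κ : Fin m → ℝ, ∀ j, κ j = ((L j).1 0 : ℝ) := ⟨_, fun _ => rfl⟩
  obtain ⟨μ, hμ⟩ : ∃ μ : Fin m → ℝ, ∀ j, μ j = ((L j).2 : ℝ) := ⟨_, fun _ => rfl⟩
  have hΦ0 : ∀ w, Φ w 0 = x₀ + w.1 := fun w => (chart_coord x₀ sl ic w).1
  have hΦ1 : ∀ w, Φ w 1 = w.2 + (sl * (x₀ + w.1) + ic) := fun w => (chart_coord x₀ sl ic w).2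
  have hyl : ∀ w, Φ w (Fin.castAdd 0 (Fin.last 1)) - affB 1 0 ℓ (Φ w) = w.2 := fun w => by
    rw [cA1, affB_eq, hΦ0, hΦ1]; ring
  have hxp : ∀ w, (fun i : Fin 1 => Φ w (Fin.castAdd 0 (Fin.castSucc i))) = fun _ => x₀ + w.1 :=
    fun w => by rw [xpart_eq, hΦ0]
  have hwall : ∀ w j, affB 1 0 (L j) (Φ w) = κ j * (x₀ + w.1) + μ j := fun w j => by
    rw [affB_eq, hΦ0, hκ, hμ]
  have hmem : ∀ w, Φ w ∈ s.domain ↔ w ∈ Om (grow M ℓ x₀) := mem_chart_iff M lo up ℓ s hdom x₀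
  -- Taylor coefficient data
  obtain ⟨N', cc, Q, hQ, hQq⟩ := exists_coeff_data N q x₀
  have hQc : ∀ i, Continuous (Q i) := fun i => by
    rw [show Q i = fun u => ∑ m ∈ Finset.range N', cc (i, m) * u ^ m from funext (hQ i)]
    fun_prop
  -- closure facts at `z₀`
  have hcl_harm : ∀ j (c₀ : ℝ), (∀ z ∈ s.domain, c₀ ≤ |affB 1 0 (L j) z|) →
      c₀ ≤ |κ j * x₀ + μ j| := fun j c₀ h => by
    have := le_of_mem_closure' (f := fun _ => c₀) (g := fun z => |affB 1 0 (L j) z|)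
      continuous_const (by simp only [affB_eq]; fun_prop) h hz₀
    simpa [affB_eq, hκ, hμ] using this
  have hcl_cone : ∀ a₁ b₁ : ℚ, (∀ z ∈ s.domain, (a₁ : ℝ) * (z 0 - V.1) < z 1 - V.2 ∧
      z 1 - V.2 < (b₁ : ℝ) * (z 0 - V.1)) →
      (a₁ : ℝ) * (x₀ - V.1) ≤ z₀ 1 - V.2 ∧ z₀ 1 - V.2 ≤ (b₁ : ℝ) * (x₀ - V.1) := fun a₁ b₁ h =>
    ⟨le_of_mem_closure' (f := fun z : Fin (1 + 1 + 0) → ℝ => (a₁ : ℝ) * (z 0 - V.1))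
      (g := fun z => z 1 - V.2) (by fun_prop) (by fun_prop) (fun z hz => (h z hz).1.le) hz₀,
     le_of_mem_closure' (f := fun z : Fin (1 + 1 + 0) → ℝ => z 1 - V.2)
      (g := fun z => (b₁ : ℝ) * (z 0 - V.1)) (by fun_prop) (by fun_prop) (fun z hz => (h z hz).2.le) hz₀⟩
  -- a wall vanishing at `x₀` is a wall through the vertex `V = z₀`, and `ℓ` passes through it
  have hvan : ∀ j, e j ≠ 0 → κ j * x₀ + μ j = 0 →
      κ j ≠ 0 ∧ x₀ = V.1 ∧ n ≠ 0 ∧ l₀ = 0 ∧ ∃ a₁ b₁ : ℚ, ∀ z ∈ s.domain,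
        (a₁ : ℝ) * (z 0 - V.1) < z 1 - V.2 ∧ z 1 - V.2 < (b₁ : ℝ) * (z 0 - V.1) := by
    intro j he h0
    rcases hInv j he with ⟨c₀, hc₀, hb⟩ | ⟨hk, hkV, hn, hℓV, a₁, b₁, hcone⟩
    · have := hcl_harm j c₀ hb; rw [h0, abs_zero] at this; linarith
    · have hk' : κ j ≠ 0 := by rw [hκ]; exact_mod_cast hk
      have hkV' : κ j * V.1 + μ j = 0 := by rw [hκ, hμ]; exact_mod_cast hkV
      have hxV : x₀ = V.1 := by
        have : κ j * (x₀ - V.1) = 0 := by linarith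
        simpa [hk', sub_eq_zero] using this
      have hℓV' : sl * V.1 + ic = V.2 := by rw [hsl, hic]; exact_mod_cast hℓV
      obtain ⟨h1, h2⟩ := hcl_cone a₁ b₁ hcone
      simp only [hxV, sub_self, mul_zero] at h1 h2
      refine ⟨hk', hxV, hn, ?_, a₁, b₁, hcone⟩
      rw [hl₀, hxV, hℓV']; linarith

  -- the integrand and the pieces read in the chart
  have hsum : ∀ w : ℝ × ℝ, ∑ i ∈ Finset.range N,
      MvPolynomial.aeval (fun _ : Fin 1 => x₀ + w.1) (q i) * w.2 ^ i =
      ∑ i ∈ Finset.range N, Q i w.1 * w.2 ^ i := fun w =>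
    Finset.sum_congr rfl fun i hi' => by rw [hQq i (Finset.mem_range.1 hi') w.1]
  have hpieceΦ : ∀ w : ℝ × ℝ, MvPolynomial.aeval (fun i => Φ w (Fin.castAdd 0 (Fin.castSucc i))) (q i) /
      (∏ j, affB 1 0 (L j) (Φ w) ^ e j) *
      ((Φ w (Fin.castAdd 0 (Fin.last 1)) - affB 1 0 ℓ (Φ w)) ^ i /
        (Φ w (Fin.castAdd 0 (Fin.last 1)) - affB 1 0 ℓ (Φ w)) ^ n) * fib 1 0 a (Φ w) =
      Q i w.1 / (∏ j, (κ j * (x₀ + w.1) + μ j) ^ e j) * (w.2 ^ i / w.2 ^ n) := fun w => by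
    rw [hxp, hyl, fib_zero, mul_one, ← hQq i hi w.1]
    simp only [hwall]
  have hpoleΦ : n ≠ 0 → ∀ w ∈ Om (grow M ℓ x₀), w.2 ≠ 0 := fun hn w hw => by
    rw [← hyl w]; exact hpole hn (Φ w) ((hmem w).2 hw)
  by_cases hA : l₀ ≠ 0 ∨ n = 0
  · -- Case A: off the pole line (or no pole): everything is bounded near `z₀`
    set W₁ : ℝ → ℝ := fun u => ∏ j, (κ j * (x₀ + u) + μ j) ^ e j with hW₁
    have hW : Continuous W₁ := by rw [hW₁]; fun_prop
    have hW0 : W₁ 0 ≠ 0 := by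
      intro h0
      rw [hW₁] at h0
      obtain ⟨j, -, hj⟩ := Finset.prod_eq_zero_iff.1 h0
      rw [add_zero] at hj
      obtain ⟨hj0, hej⟩ := pow_eq_zero_iff'.1 hj
      obtain ⟨-, -, hn, hl, -⟩ := hvan j hej hj0
      exact hA.elim (fun h => h hl) (fun h => hn h)
    obtain ⟨ρ, hρ, hIw⟩ := core_away (measurableSet_Om (grow M ℓ x₀)) hQc W₁ hW hW0 n i l₀
      (fun hn => hA.elim id fun h => absurd h hn)
    refine ⟨{z | |z 0 - x₀| < ρ ∧ |z 1 - (sl * z 0 + ic) - l₀| < ρ}, ?_, ?_, ?_⟩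
    · exact (isOpen_lt (by fun_prop) continuous_const).and (isOpen_lt (by fun_prop) continuous_const)
    · refine ⟨by simpa [hx₀] using hρ, ?_⟩
      show |z₀ 1 - (sl * z₀ 0 + ic) - l₀| < ρ
      rw [hl₀, hx₀, sub_self, abs_zero]; exact hρ
    · refine integrableOn_of_chart M lo up ℓ s hdom x₀ (B := {w | |w.1| < ρ ∧ |w.2 - l₀| < ρ})
        ((measurableSet_lt measurable_fst.abs measurable_const).inter
          (measurableSet_lt (measurable_snd.sub measurable_const).abs measurable_const))
        (fun w => ?_) (fun w _ => ?_) hIw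
      · show Φ w ∈ _ ↔ _
        simp only [mem_setOf_eq, hΦ0, hΦ1]
        rw [show x₀ + w.1 - x₀ = w.1 by ring,
          show w.2 + (sl * (x₀ + w.1) + ic) - (sl * (x₀ + w.1) + ic) - l₀ = w.2 - l₀ by ring]
      · show _ = piece Q W₁ 0 n i w
        rw [hpieceΦ w]
        simp only [piece, pow_zero, one_mul, hW₁]
  · -- Case B: on the pole line: the local core at `z₀ = (x₀, ℓ(x₀))`
    push Not at hA
    obtain ⟨hl00, hn⟩ := hA
    obtain ⟨E, W₁, hW, hW0, hEj, hfac⟩ := wall_factor κ μ e x₀ fun j h0 he => (hvan j he h0).1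
    set g := grow M ℓ x₀ with hg
    have h0 : ∀ j, 0 ≤ aff (g j) 0 := fun j => by
      rw [hg, aff_grow]
      have hz : (chart x₀ (ℓ.1 0) ℓ.2 0 : Fin (1 + 1 + 0) → ℝ) = z₀ := by
        ext k
        fin_cases k
        · simp [hx₀]
        · show (0 : ℝ) + ((ℓ.1 0 : ℝ) * (x₀ + 0) + ℓ.2) = z₀ 1
          have : z₀ 1 = sl * x₀ + ic := by linarith
          rw [this, hsl, hic]; ring
      rw [hz]
      refine le_of_mem_closure' (f := fun _ => (0 : ℝ))
        (g := fun z : Fin (1 + 1 + 0) → ℝ => ∑ i, ((M j).1 i : ℝ) * z (Fin.castAdd 0 i) + (M j).2)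
        continuous_const (by simp only [rowval_eq]; fun_prop) (fun z hz => ?_) hz₀
      rw [hdom] at hz
      exact (hz.1 j).le
    have hE : E ≠ 0 → ∃ C, ∀ w ∈ Om g, |w.2| ≤ C * |w.1| := fun hE0 => by
      obtain ⟨j, hj0, hej⟩ := hEj hE0
      obtain ⟨-, hxV, -, -, a₁, b₁, hcone⟩ := hvan j hej hj0
      have hℓV : sl * V.1 + ic = V.2 := by
        have : l₀ = 0 := hl00
        rw [hl₀, hxV] at this
        have h2 : z₀ 1 - V.2 = 0 := by
          obtain ⟨h1, h2⟩ := hcl_cone a₁ b₁ hcone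
          simp only [hxV, sub_self, mul_zero] at h1 h2; linarith
        linarith
      refine ⟨|(a₁ : ℝ) - sl| + |(b₁ : ℝ) - sl|, fun w hw => ?_⟩
      have hc := hcone (Φ w) ((hmem w).2 hw)
      rw [hΦ0, hΦ1, hxV] at hc
      have e1 : (V.1 : ℝ) + w.1 - V.1 = w.1 := by ring
      have e2 : w.2 + (sl * (V.1 + w.1) + ic) - V.2 = w.2 + sl * w.1 := by linarith
      rw [e1, e2] at hc
      obtain ⟨hc1, hc2⟩ := hc
      have hb1 : ((b₁ : ℝ) - sl) * w.1 ≤ |(b₁ : ℝ) - sl| * |w.1| := by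
        rw [← abs_mul]; exact le_abs_self _
      have hb2 : (sl - (a₁ : ℝ)) * w.1 ≤ |(a₁ : ℝ) - sl| * |w.1| := by
        rw [abs_sub_comm, ← abs_mul]; exact le_abs_self _
      rw [abs_le]; constructor <;> nlinarith [abs_nonneg w.1, abs_nonneg ((a₁:ℝ) - sl),
        abs_nonneg ((b₁ : ℝ) - sl)]
    -- the integrand in the chart
    set F : ℝ × ℝ → ℝ := fun w => s.integrand (Φ w) with hF
    have hFint : IntegrableOn F (Om g) := by
      have := ((measurePreserving_chart x₀ sl ic).integrableOn_comp_preimage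
        (chart x₀ sl ic).measurableEmbedding (f := s.integrand) (s := s.domain)).2 s.integrableOn
      rwa [show (chart x₀ sl ic) ⁻¹' s.domain = Om g from preimage_chart M lo up ℓ s hdom x₀] at this
    have hFeq : EqOn F (fun w => (∑ i ∈ Finset.range N, Q i w.1 * w.2 ^ i) / (w.1 ^ E * W₁ w.1) *
        (1 / w.2) ^ n) (Om g) := fun w hw => by
      show s.integrand (Φ w) = _
      rw [hint ((hmem w).2 hw)]
      simp only [hq, hxp, hyl, fib_zero, mul_one, hwall, hsum, hfac, one_div_pow]
    obtain ⟨ρW, hρW, CW, hCW, -, hWb⟩ := W_bounds hW hW0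
    have hlt : (Om g).Nonempty → ∀ D : ℕ,
        (∀ im ∈ Finset.range N ×ˢ Finset.range N', cc im ≠ 0 → D ≤ im.1 + im.2) →
        (∃ im₀ ∈ Finset.range N ×ˢ Finset.range N', cc im₀ ≠ 0 ∧ im₀.1 + im₀.2 = D) →
        n + E < D + 2 := fun hne D hd him₀ =>
      exponent_lt g _ cc hd him₀ W₁ hW0 hρW hCW hWb h0 hne F hFint (fun w hw => by
        rw [hFeq hw]; simp only [dsum_product, hQ]) hpoleΦ
    obtain ⟨ρ, hρ, hIw⟩ := core g h0 cc Q hQ W₁ hW hW0 hE F hFint hFeq hpoleΦ hlt i hi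
    refine ⟨{z | |z 0 - x₀| < ρ ∧ |z 1 - (sl * z 0 + ic)| < ρ}, ?_, ?_, ?_⟩
    · exact (isOpen_lt (by fun_prop) continuous_const).and (isOpen_lt (by fun_prop) continuous_const)
    · refine ⟨by simpa [hx₀] using hρ, ?_⟩
      show |z₀ 1 - (sl * z₀ 0 + ic)| < ρ
      rw [← hx₀, ← hl₀, hl00, abs_zero]; exact hρ
    · refine integrableOn_of_chart M lo up ℓ s hdom x₀ (B := box ρ) (measurableSet_box ρ)
        (fun w => ?_) (fun w _ => ?_) hIw
      · show Φ w ∈ _ ↔ _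
        simp only [mem_setOf_eq, hΦ0, hΦ1, box]
        rw [show x₀ + w.1 - x₀ = w.1 by ring,
          show w.2 + (sl * (x₀ + w.1) + ic) - (sl * (x₀ + w.1) + ic) = w.2 by ring]
      · show _ = piece Q W₁ E n i w
        rw [hpieceΦ w, hfac w.1]
        simp only [piece]

end LocalPiece

section Terminal

/-- **Terminal theorem.** A terminal representation of the far-first separation (polyhedral base
cell, shape with all active letters equal to `ℓ`, walls either bounded away from zero on the cell
or through the vertex `V` with the cone condition and `ℓ ∋ V`) is congruent modulo `KZ.relations`
to a `ℤ`-combination of elements of `GG 1 1 0`: Taylor split at `ℓ` (`separatePos_split`), the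
termwise absolute convergence being LOCAL (`local_piece`) + compactness of the closed cell. -/
theorem terminal {m' r : ℕ} (M : Fin m' → (Fin (1 + 1) → ℚ) × ℚ)
    (p : MvPolynomial (Fin (1 + 1)) ℚ) (lam : Fin r → (Fin 1 → ℚ) × ℚ)
    (a : Fin 0 → Option ((Fin (1 + 1) → ℚ) × ℚ))
    (lo up : Fin 0 → Fin 0 ⊕ ((Fin (1 + 1) → ℚ) × ℚ)) (V : ℚ × ℚ)
    {m : ℕ} (L : Fin m → (Fin 1 → ℚ) × ℚ) (e : Fin m → ℕ) (d : Fin r → ℕ)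
    (s : KZ.IntegralRep (1 + 1 + 0)) (ℓ : (Fin 1 → ℚ) × ℚ)
    (hbd : Bornology.IsBounded s.domain) (hdom : s.domain = gDom 1 0 m' M lo up)
    (hint : EqOn s.integrand (shape 1 0 p L e lam d a) s.domain)
    (hpole : ∀ j, d j ≠ 0 → ∀ z ∈ s.domain,
      z (Fin.castAdd 0 (Fin.last 1)) - affB 1 0 (lam j) z ≠ 0)
    (hℓ : ∀ j, d j ≠ 0 → lam j = ℓ)
    (hInv : ∀ j, e j ≠ 0 → (∃ c₀ > 0, ∀ z ∈ s.domain, c₀ ≤ |affB 1 0 (L j) z|) ∨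
      ((L j).1 0 ≠ 0 ∧ (L j).1 0 * V.1 + (L j).2 = 0 ∧ (∃ i, d i ≠ 0) ∧
        (∀ i, d i ≠ 0 → (lam i).1 0 * V.1 + (lam i).2 = V.2) ∧
        ∃ a₁ b₁ : ℚ, ∀ z ∈ s.domain, (a₁ : ℝ) * (z 0 - V.1) < z 1 - V.2 ∧
          z 1 - V.2 < (b₁ : ℝ) * (z 0 - V.1))) :
    ∃ c ∈ AddSubgroup.closure (GGset 1 1 0), KZ.of s - c ∈ KZ.relations := by
  set n := ∑ j, d j with hn
  -- single-pole form of the integrand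
  have hint' : EqOn s.integrand (fun z => MvPolynomial.aeval (fun i => z (Fin.castAdd 0 i)) p /
      (∏ j, (∑ i, ((L j).1 i : ℝ) * z (Fin.castAdd 0 (Fin.castSucc i)) + ((L j).2 : ℝ)) ^ e j) *
      (1 / (z (Fin.castAdd 0 (Fin.last 1)) - (∑ i, (ℓ.1 i : ℝ) * z (Fin.castAdd 0
        (Fin.castSucc i)) + (ℓ.2 : ℝ))) ^ n) *
      ∏ i, (a i).elim 1 (fun c => 1 / (z (Fin.natAdd (1 + 1) i) -
        (∑ i', (c.1 i' : ℝ) * z (Fin.castAdd 0 i') + (c.2 : ℝ))))) s.domain := by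
    intro z hz
    rw [hint hz]
    simp only [shape, fib, affB, one_div]
    congr 2
    rw [← Finset.prod_pow_eq_pow_sum, ← Finset.prod_inv_distrib]
    refine Finset.prod_congr rfl fun j _ => ?_
    by_cases hj : d j = 0
    · simp [hj]
    · rw [hℓ j hj]
  have hact : n ≠ 0 → ∃ j, d j ≠ 0 := fun h => by
    by_contra hall; push Not at hall
    exact h (Finset.sum_eq_zero fun j _ => hall j)
  have hpole' : n ≠ 0 → ∀ z ∈ s.domain, z (Fin.castAdd 0 (Fin.last 1)) -
      (∑ i, (ℓ.1 i : ℝ) * z (Fin.castAdd 0 (Fin.castSucc i)) + (ℓ.2 : ℝ)) ≠ 0 := fun h z hz => by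
    obtain ⟨j, hj⟩ := hact h
    have := hpole j hj z hz
    rwa [hℓ j hj] at this
  obtain ⟨N, q, hq⟩ := separatePos_taylor 1 0 p ℓ
  refine separatePos_split GGset (fun _ _ _ => rfl) 1 0 m m' n s M L e p ℓ a lo up hpole' hbd hdom
    hint' N q hq fun i hi => ?_
  -- termwise absolute convergence: local + compact
  have hInv' : ∀ j, e j ≠ 0 → (∃ c₀ > 0, ∀ z ∈ s.domain, c₀ ≤ |affB 1 0 (L j) z|) ∨
      ((L j).1 0 ≠ 0 ∧ (L j).1 0 * V.1 + (L j).2 = 0 ∧ n ≠ 0 ∧ ℓ.1 0 * V.1 + ℓ.2 = V.2 ∧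
        ∃ a₁ b₁ : ℚ, ∀ z ∈ s.domain, (a₁ : ℝ) * (z 0 - V.1) < z 1 - V.2 ∧
          z 1 - V.2 < (b₁ : ℝ) * (z 0 - V.1)) := by
    intro j hj
    rcases hInv j hj with h | ⟨h1, h2, ⟨i₀, hi₀⟩, h4, h5⟩
    · exact Or.inl h
    · refine Or.inr ⟨h1, h2, fun h0 => hi₀ ((Finset.sum_eq_zero_iff.1 h0) i₀ (Finset.mem_univ _)),
        ?_, h5⟩
      rw [← hℓ i₀ hi₀]; exact h4 i₀ hi₀
  exact integrableOn_of_forall_nhds hbd.isCompact_closure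
    (local_piece M lo up L e ℓ s hdom a p n hint' hpole' V hInv' N q hq i (Finset.mem_range.1 hi))

end Terminal

end SepTwoZero

open SepTwoZero SeparatePos in
/-- **Terminal theorem** (registered sub-goal of `stub_separateTwoZero`; see `SepTwoZero.terminal`). -/
theorem separateTwoZero_terminal {m' r : ℕ} (M : Fin m' → (Fin (1 + 1) → ℚ) × ℚ) (p : MvPolynomial (Fin (1 + 1)) ℚ) (lam : Fin r → (Fin 1 → ℚ) × ℚ) (a : Fin 0 → Option ((Fin (1 + 1) → ℚ) × ℚ)) (lo up : Fin 0 → Fin 0 ⊕ ((Fin (1 + 1) → ℚ) × ℚ)) (V : ℚ × ℚ) {m : ℕ} (L : Fin m → (Fin 1 → ℚ) × ℚ) (e : Fin m → ℕ) (d : Fin r → ℕ) (s : KZ.IntegralRep (1 + 1 + 0)) (ℓ : (Fin 1 → ℚ) × ℚ) (hbd : Bornology.IsBounded s.domain) (hdom : s.domain = SeparatePos.gDom 1 0 m' M lo up) (hint : EqOn s.integrand (SeparatePos.shape 1 0 p L e lam d a) s.domain) (hpole : ∀ j, d j ≠ 0 → ∀ z ∈ s.domain, z (Fin.castAdd 0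 (Fin.last 1)) - SeparatePos.affB 1 0 (lam j) z ≠ 0) (hℓ : ∀ j, d j ≠ 0 → lam j = ℓ) (hInv : ∀ j, e j ≠ 0 → (∃ c₀ > 0, ∀ z ∈ s.domain, c₀ ≤ |SeparatePos.affB 1 0 (L j) z|) ∨ ((L j).1 0 ≠ 0 ∧ (L j).1 0 * V.1 + (L j).2 = 0 ∧ (∃ i, d i ≠ 0) ∧ (∀ i, d i ≠ 0 → (lam i).1 0 * V.1 + (lam i).2 = V.2) ∧ ∃ a₁ b₁ : ℚ, ∀ z ∈ s.domain, (a₁ : ℝ) * (z 0 - V.1) < z 1 - V.2 ∧ z 1 - V.2 < (b₁ : ℝ) * (z 0 - V.1))) : ∃ c ∈ AddSubgroup.closure (SeparatePos.GGset 1 1 0), KZ.of s - c ∈ KZ.relations := by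
  exact terminal M p lam a lo up V L e d s ℓ hbd hdom hint hpole hℓ hInv

end Summit.KontsevichZagierPeriods.ArrangementNormalForm.JanusBands
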